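import Literature.MathematicalPhysics.StatisticalMechanics.CubicLatticeVoxelPerimeter
import Literature.MathematicalPhysics.StatisticalMechanics.CubicLatticeEIPAsymptotics
import Literature.Analysis.Convexity.QuantitativeWulffInequality
import HarnessLib

/-!
# Cicalese–Leonardi's almost-minimiser fluctuation law on `ℤ^d`, closed modulo the
# Figalli–Maggi–Pratelli quantitative Wulff inequality

Topic `Literature/MathematicalPhysics/StatisticalMechanics`.  The named fact
`CicaleseLeonardi2020.CicaleseLeonardi2020_cubicLattice` of `LatticeMaximalFluctuations.lean` — §3.1 of
[CicaleseLeonardi2020]: for `d ≥ 2` there is `c_d` with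
`inf_{x∈ℝ^d} |V(X) △ (x + W_N)| ≤ c_d (α_N N^{(d+1)/d} + N^{2−1/d})^{1/2}` for every `N`-point `X ⊂ ℤ^d`
whose excess energy is within `α_N` of the minimum — is DERIVED here from the tree's named fact
`Literature.Analysis.Convexity.FigalliMaggiPratelli2010_quantitativeWulff` (the source's Theorem 2.1 =
Figalli–Maggi–Pratelli 2010, Theorem 1.1) and otherwise PROVED ingredients only:

* (2.11) for `F = P_1`: the FMP fact at the open cube `W = (−1,1)^d` (density `‖ν‖_W = ‖ν‖₁`, Wulff
  shapes `W_v` = open cubes of volume `v`; `openUnitCube_facts`, `normalisedDilate_openUnitCube`);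
* (2.13) with `β_N = 0`: `F(ζ(X)) ≤ E_N(X)` — `anisotropicPerimeter_cubeUnion_le`
  (`CubicLatticeVoxelPerimeter.lean`, every dimension);
* (2.14) with (3.20): `inf E_N = EIP^d(N) ≤ 2dN^{(d−1)/d} + C_d N^{(d−2)/d} = F(W_N) + C_d N^{1−2/d}` —
  `eipValue_le_rpow` (`CubicLatticeEIPAsymptotics.lean`) and the exact value
  `F(W_N) = 2d N^{(d−1)/d}` (`anisotropicPerimeter_closure_normalisedDilate`, `QuantitativeWulffInequality.lean`);
* `|ζ(X)| = #X = N` (`volume_cubeUnion_image_intVec`), `ζ(X)` of finite perimeter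
  (`mul_perimeter_le_anisotropicPerimeter`), and the null-set passage from the open Wulff cube of the FMP
  fact to the closed cube `W_N = N^{1/d}[−½,½]^d` of the typed statement
  (`vadd_openCube_ae_eq_vadd_closedCube`);
* the three-line Proposition 1 (here inlined as `deviation_arith`:
  `N·C·√((F(D) − F(W_N))/F(W_N)) ≤ C(1 + C_d)(α N^{(d+1)/d} + N^{2−1/d})^{1/2}`).

Main statement: `CicaleseLeonardi2020.CicaleseLeonardi2020_cubicLattice_of_quantitativeWulff :
FigalliMaggiPratelli2010_quantitativeWulff → CicaleseLeonardi2020_cubicLattice`.  No definition and no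
named fact is introduced; when the FMP fact is discharged, `CicaleseLeonardi2020_cubicLattice_holds` is a
one-line corollary.

## Source, as printed

M. Cicalese, G. P. Leonardi, Comm. Math. Phys. **375** (2020) 1931–1944 [CicaleseLeonardi2020], p. 5–7
(held text `paper:doi-10-1007-s00220-019-03612-3`): Proposition 1 (2.15) and its proof (p. 5); §3.1:
"(3.17) holds for all `D ∈ M` with finite perimeter and `|D| = v`.  Fix `N ∈ ℕ` and let `E_N` be as in
(2.10).  We clearly have `|ζ(X)| = #(X)` and `F(ζ(X)) = E_N(X)` whenever `X ∈ 𝒳_N`.  Moreover, (2.13) and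
(2.14) trivially hold with `β_N = 0` and `γ_N = inf_{Y∈𝒳} E_N(Y) − inf_{|D|=N} F(D)` (3.18)" (p. 6);
"(3.19) … `≤ c_1 (…(α_N + γ_N)/(2dN^{1−1/d}))^{1/2} …`", "(3.20) `γ_N ≤ C_d N^{1−2/d}`", "By plugging (3.20)
into (3.19) we finally obtain `inf_x |V(X) △ (x + W_N)| ≤ … ≤ c_d (α_N N^{(d+1)/d} + N^{2−1/d})^{1/2}`"
(p. 7).

## References

* [CicaleseLeonardi2020] M. Cicalese, G. P. Leonardi, *Maximal fluctuations on periodic lattices: an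
  approach via quantitative Wulff inequalities*, Comm. Math. Phys. 375 (2020) 1931–1944, §2–§3.1.
* [FigalliMaggiPratelli2010] A. Figalli, F. Maggi, A. Pratelli, *A mass transportation approach to
  quantitative isoperimetric inequalities*, Invent. Math. 182 (2010) 167–211, Theorem 1.1 (the named fact
  this file is conditional on).
-/

noncomputable section

open Finset MeasureTheory
open scoped symmDiff ENNReal Pointwise

namespace Literature.MathematicalPhysics.StatisticalMechanics

open Literature.Probability.LatticeModels
open Literature.Algebra.EuclideanLattices (intVec intVec_apply intVec_injective)
open Literature.Analysis.Convexity (anisotropicPerimeter)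

/-! ### H5: Cicalese–Leonardi's cubic-lattice fact, closed modulo Figalli–Maggi–Pratelli -/

section AlmostMinimizers

open Literature.Analysis.Convexity

/-- The open cube `W = (−1,1)^d ⊂ ℝ^d` of Cicalese–Leonardi's Theorem 2.1 applied to `P_1` ("this norm
coincides with the norm `‖ν‖_W` associated with the unitary cell of the lattice", p. 6 — here scaled by `2` so
that `‖ν‖_W = ‖ν‖₁` exactly): open, bounded, convex, contains `0`, has volume `2^d`, its closure lies in
`[−1,1]^d` and contains the ball of radius `½`. [cite: CicaleseLeonardi2020, Theorem 2.1 p. 5 and §3.1 p. 6] -/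
theorem openUnitCube_facts (d : ℕ) :
    IsOpen {y : EuclideanSpace ℝ (Fin d) | ∀ i, |y i| < 1} ∧
    Bornology.IsBounded {y : EuclideanSpace ℝ (Fin d) | ∀ i, |y i| < 1} ∧
    Convex ℝ {y : EuclideanSpace ℝ (Fin d) | ∀ i, |y i| < 1} ∧
    (0 : EuclideanSpace ℝ (Fin d)) ∈ {y : EuclideanSpace ℝ (Fin d) | ∀ i, |y i| < 1} ∧
    volume {y : EuclideanSpace ℝ (Fin d) | ∀ i, |y i| < 1} = ENNReal.ofReal ((2 : ℝ) ^ d) ∧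
    closure {y : EuclideanSpace ℝ (Fin d) | ∀ i, |y i| < 1} ⊆ {k | ∀ i, |k i| ≤ 1} ∧
    Metric.closedBall (0 : EuclideanSpace ℝ (Fin d)) (1 / 2) ⊆
      closure {y : EuclideanSpace ℝ (Fin d) | ∀ i, |y i| < 1} := by
  set W := {y : EuclideanSpace ℝ (Fin d) | ∀ i, |y i| < 1} with hW
  have hWeq : W = ⋂ i, {y : EuclideanSpace ℝ (Fin d) | |y i| < 1} := by ext y; simp [hW]
  refine ⟨?_, ?_, ?_, ?_, ?_, ?_, ?_⟩
  · rw [hWeq]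
    exact isOpen_iInter_of_finite fun i => isOpen_lt (by fun_prop) continuous_const
  · rw [isBounded_iff_forall_norm_le]
    refine ⟨Real.sqrt d, fun y hy => ?_⟩
    rw [EuclideanSpace.norm_eq]
    refine Real.sqrt_le_sqrt ?_
    calc ∑ i, ‖y i‖ ^ 2 ≤ ∑ _i : Fin d, (1 : ℝ) := Finset.sum_le_sum fun i _ => by
            rw [Real.norm_eq_abs]
            exact pow_le_one₀ (abs_nonneg _) (hy i).le
      _ = d := by simp
  · rw [hWeq]
    refine convex_iInter fun i => ?_
    have hlin : IsLinearMap ℝ fun y : EuclideanSpace ℝ (Fin d) => y i :=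
      ⟨fun x y => by simp, fun c x => by simp⟩
    have e : {y : EuclideanSpace ℝ (Fin d) | |y i| < 1} = {y | y i < 1} ∩ {y | -1 < y i} := by
      ext y; simp [abs_lt, and_comm]
    rw [e]
    exact (convex_halfSpace_lt hlin 1).inter (convex_halfSpace_gt hlin (-1))
  · simp [hW]
  · have h := (EuclideanSpace.volume_preserving_symm_measurableEquiv_toLp (Fin d)).measure_preimage_equiv
      (Set.univ.pi fun _ : Fin d => Set.Ioo (-1 : ℝ) 1)
    rw [Real.volume_pi_Ioo] at h
    simp only [show (1 : ℝ) - -1 = 2 by norm_num, prod_const, card_univ, Fintype.card_fin] at h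
    have hset : W = (MeasurableEquiv.toLp 2 (Fin d → ℝ)).symm ⁻¹' (Set.univ.pi fun _ : Fin d => Set.Ioo (-1 : ℝ) 1) := by
      ext y
      simp only [hW, Set.mem_setOf_eq, Set.mem_preimage, Set.mem_univ_pi, Set.mem_Ioo,
        MeasurableEquiv.coe_toLp_symm, abs_lt]
    rw [hset, h, ENNReal.ofReal_pow (by norm_num)]
  · refine closure_minimal (fun y hy i => (hy i).le) ?_
    have e : {k : EuclideanSpace ℝ (Fin d) | ∀ i, |k i| ≤ 1} = ⋂ i, {k | |k i| ≤ 1} := by ext; simp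
    rw [e]
    exact isClosed_iInter fun i => isClosed_le (by fun_prop) continuous_const
  · intro y hy
    apply subset_closure
    rw [Metric.mem_closedBall, dist_zero_right] at hy
    intro i
    have := PiLp.norm_apply_le y i
    rw [Real.norm_eq_abs] at this
    linarith

/-- The normalised dilate of `(−1,1)^d` of volume `N > 0` is the open cube of side `N^{1/d}`:
`W_N = {y : |y_i| < N^{1/d}/2}` ("`W_v = v^{1/d} W`", the interior of the typed `wulffCube d N`).
[cite: CicaleseLeonardi2020, Theorem 2.1 p. 5, §3.1 p. 6 (`W_v = v^{1/d}[−½,½]^d`)] -/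
theorem normalisedDilate_openUnitCube {d : ℕ} (hd : 1 ≤ d) {N : ℝ} (hN : 0 < N) :
    normalisedDilate {y : EuclideanSpace ℝ (Fin d) | ∀ i, |y i| < 1} N =
      {y : EuclideanSpace ℝ (Fin d) | ∀ i, |y i| < N ^ ((1 : ℝ) / (d : ℝ)) / 2} := by
  obtain ⟨-, -, -, -, hvol, -, -⟩ := openUnitCube_facts d
  have hd0 : (d : ℝ) ≠ 0 := by exact_mod_cast (show d ≠ 0 by omega)
  have hr : (N / (2 : ℝ) ^ d) ^ ((1 : ℝ) / (d : ℝ)) = N ^ ((1 : ℝ) / (d : ℝ)) / 2 := by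
    rw [Real.div_rpow hN.le (by positivity), ← Real.rpow_natCast (2 : ℝ) d, ← Real.rpow_mul (by norm_num),
      mul_one_div_cancel hd0, Real.rpow_one]
  have hrpos : 0 < N ^ ((1 : ℝ) / (d : ℝ)) / 2 := by positivity
  rw [normalisedDilate, hvol, ENNReal.toReal_ofReal (by positivity), hr]
  ext y
  rw [Set.mem_smul_set_iff_inv_smul_mem₀ hrpos.ne']
  simp only [Set.mem_setOf_eq, PiLp.smul_apply, smul_eq_mul, abs_mul, abs_inv, abs_of_pos hrpos]
  refine forall_congr' fun i => ?_
  rw [inv_mul_lt_iff₀ hrpos, mul_one]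

/-- The open and the closed cube of half-side `s` around a point agree a.e. ("unique, up to null sets
and translations", (2.11)). [cite: CicaleseLeonardi2020, (2.11) p. 5] -/
theorem vadd_openCube_ae_eq_vadd_closedCube {d : ℕ} (x : EuclideanSpace ℝ (Fin d)) (s : ℝ) :
    (x +ᵥ {y : EuclideanSpace ℝ (Fin d) | ∀ i, |y i| < s} : Set (EuclideanSpace ℝ (Fin d))) =ᵐ[volume]
      x +ᵥ {y : EuclideanSpace ℝ (Fin d) | ∀ i, |y i| ≤ s} := by
  rw [← measure_symmDiff_eq_zero_iff, ← Set.vadd_set_symmDiff, measure_vadd]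
  have hsub : {y : EuclideanSpace ℝ (Fin d) | ∀ i, |y i| < s} ⊆ {y | ∀ i, |y i| ≤ s} :=
    fun y hy i => (hy i).le
  rw [symmDiff_of_le hsub]
  -- the difference lies in finitely many degenerate boxes
  have hcov : {y : EuclideanSpace ℝ (Fin d) | ∀ i, |y i| ≤ s} \ {y | ∀ i, |y i| < s} ⊆
      ⋃ p : Fin d × Bool, {y : EuclideanSpace ℝ (Fin d) | ∀ j,
        Function.update (fun _ : Fin d => -s) p.1 (if p.2 then s else -s) j ≤ y j ∧
          y j ≤ Function.update (fun _ : Fin d => s) p.1 (if p.2 then s else -s) j} := by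
    intro y hy
    rw [Set.mem_sdiff, Set.mem_setOf_eq, Set.mem_setOf_eq, not_forall] at hy
    obtain ⟨h1, ⟨t, ht⟩⟩ := hy
    have hyt : y t = s ∨ y t = -s := by
      have := h1 t
      rw [abs_le] at this
      rw [abs_lt, not_and_or] at ht
      rcases ht with ht | ht
      · right; linarith
      · left; linarith
    rw [Set.mem_iUnion]
    rcases hyt with hyt | hyt
    · refine ⟨(t, true), fun j => ?_⟩
      by_cases hj : j = t
      · subst hj; simp [hyt]
      · simp only [Function.update_of_ne hj, if_true]
        exact abs_le.1 (h1 j)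
    · refine ⟨(t, false), fun j => ?_⟩
      by_cases hj : j = t
      · subst hj; simp [hyt]
      · simp only [Function.update_of_ne hj]
        exact abs_le.1 (h1 j)
  refine measure_mono_null hcov ((measure_iUnion_null_iff).2 fun p => ?_)
  rw [volume_setOf_forall_le_and_le]
  exact Finset.prod_eq_zero (Finset.mem_univ p.1) (by simp)

/-- `|V(ι C)| = #C` exactly ("We clearly have `|ζ(X)| = #(X)`", p. 6).
[cite: CicaleseLeonardi2020, §3.1 p. 6] -/
theorem volume_cubeUnion_image_intVec {d : ℕ} (C : Finset (Site d)) :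
    volume (CicaleseLeonardi2020.cubeUnion (C.image (intVec d))) = (#C : ℝ≥0∞) := by
  classical
  refine le_antisymm ?_ ?_
  · refine (CicaleseLeonardi2020.volume_cubeUnion_le_card _).trans ?_
    rw [card_image_of_injective _ (intVec_injective d)]
  · have h := card_symmDiff_le_volume_cubeUnion_symmDiff C ∅
    have e0 : C ∆ (∅ : Finset (Site d)) = C := by rw [← Finset.bot_eq_empty, symmDiff_bot]
    have e : CicaleseLeonardi2020.cubeUnion ((∅ : Finset (Site d)).image (intVec d)) = ∅ := by
      simp [CicaleseLeonardi2020.cubeUnion]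
    have e2 : CicaleseLeonardi2020.cubeUnion (C.image (intVec d)) ∆ (∅ : Set (EuclideanSpace ℝ (Fin d))) =
        CicaleseLeonardi2020.cubeUnion (C.image (intVec d)) := by rw [← Set.bot_eq_empty, symmDiff_bot]
    rwa [e0, e, e2] at h

/-- Real bookkeeping for the assembly = the arithmetic of Proposition 1 with (3.19)–(3.20):
`N·C·√((F(D) − 2dN^{θ₁})/(2dN^{θ₁})) ≤ C(1+C₁)(αN^{(d+1)/d} + N^{2−1/d})^{1/2}` when
`F(D) ≤ 2dN^{θ₁} + C₁N^{θ₂} + α`. [folklore] -/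
private theorem deviation_arith {d : ℕ} (hd : 2 ≤ d) {N : ℕ} (hN : 1 ≤ N) {C C₁ α F : ℝ} (hC : 0 ≤ C)
    (hC₁ : 0 ≤ C₁) (hα : 0 ≤ α)
    (hF : F ≤ 2 * d * (N : ℝ) ^ (((d : ℝ) - 1) / d) + C₁ * (N : ℝ) ^ (((d : ℝ) - 2) / d) + α) :
    (N : ℝ) * (C * Real.sqrt ((F - 2 * d * (N : ℝ) ^ (((d : ℝ) - 1) / d)) /
        (2 * d * (N : ℝ) ^ (((d : ℝ) - 1) / d)))) ≤
      C * (1 + C₁) * (α * (N : ℝ) ^ (((d : ℝ) + 1) / (d : ℝ)) +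
        (N : ℝ) ^ ((2 : ℝ) - 1 / (d : ℝ))) ^ ((1 : ℝ) / 2) := by
  have hNpos : (0 : ℝ) < N := by exact_mod_cast hN
  have hdpos : (0 : ℝ) < d := by exact_mod_cast (show 0 < d by omega)
  set θ₁ := ((d : ℝ) - 1) / d with hθ₁
  set θ₂ := ((d : ℝ) - 2) / d with hθ₂
  set S := α * (N : ℝ) ^ (((d : ℝ) + 1) / (d : ℝ)) + (N : ℝ) ^ ((2 : ℝ) - 1 / (d : ℝ)) with hS
  have hL : 0 < 2 * d * (N : ℝ) ^ θ₁ := by positivity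
  have hS0 : 0 ≤ S := by positivity
  -- exponent identities
  have e1 : (N : ℝ) ^ (2 : ℕ) * (N : ℝ) ^ θ₂ / (N : ℝ) ^ θ₁ = (N : ℝ) ^ ((2 : ℝ) - 1 / (d : ℝ)) := by
    rw [← Real.rpow_natCast, ← Real.rpow_add hNpos, ← Real.rpow_sub hNpos]
    congr 1
    rw [hθ₁, hθ₂]; field_simp; ring
  have e2 : (N : ℝ) ^ (2 : ℕ) / (N : ℝ) ^ θ₁ = (N : ℝ) ^ (((d : ℝ) + 1) / (d : ℝ)) := by
    rw [← Real.rpow_natCast, ← Real.rpow_sub hNpos]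
    congr 1
    rw [hθ₁]; field_simp; ring
  -- the quantity under the square root
  have hq : (N : ℝ) ^ (2 : ℕ) * ((F - 2 * d * (N : ℝ) ^ θ₁) / (2 * d * (N : ℝ) ^ θ₁)) ≤ (1 + C₁) * S := by
    have h1 : (F - 2 * d * (N : ℝ) ^ θ₁) / (2 * d * (N : ℝ) ^ θ₁) ≤
        (C₁ * (N : ℝ) ^ θ₂ + α) / (2 * d * (N : ℝ) ^ θ₁) :=
      div_le_div_of_nonneg_right (by linarith) hL.le
    have h2 : (C₁ * (N : ℝ) ^ θ₂ + α) / (2 * d * (N : ℝ) ^ θ₁) ≤ (C₁ * (N : ℝ) ^ θ₂ + α) / (N : ℝ) ^ θ₁ := by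
      apply div_le_div_of_nonneg_left (by positivity) (by positivity)
      have : (1 : ℝ) ≤ 2 * d := by linarith [show (2 : ℝ) ≤ d by exact_mod_cast hd]
      nlinarith [Real.rpow_nonneg hNpos.le θ₁]
    have h3 : (N : ℝ) ^ (2 : ℕ) * ((C₁ * (N : ℝ) ^ θ₂ + α) / (N : ℝ) ^ θ₁) = C₁ * (N : ℝ) ^ ((2 : ℝ) - 1 / (d : ℝ)) +
        α * (N : ℝ) ^ (((d : ℝ) + 1) / (d : ℝ)) := by
      rw [← e1, ← e2]; ring
    calc (N : ℝ) ^ (2 : ℕ) * ((F - 2 * d * (N : ℝ) ^ θ₁) / (2 * d * (N : ℝ) ^ θ₁))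
        ≤ (N : ℝ) ^ (2 : ℕ) * ((C₁ * (N : ℝ) ^ θ₂ + α) / (N : ℝ) ^ θ₁) :=
          mul_le_mul_of_nonneg_left (h1.trans h2) (by positivity)
      _ = C₁ * (N : ℝ) ^ ((2 : ℝ) - 1 / (d : ℝ)) + α * (N : ℝ) ^ (((d : ℝ) + 1) / (d : ℝ)) := h3
      _ ≤ (1 + C₁) * S := by
          have p0 : 0 ≤ (N : ℝ) ^ ((2 : ℝ) - 1 / (d : ℝ)) := Real.rpow_nonneg hNpos.le _
          have p1 : 0 ≤ C₁ * α * (N : ℝ) ^ (((d : ℝ) + 1) / (d : ℝ)) := by positivity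
          have e : (1 + C₁) * S - (C₁ * (N : ℝ) ^ ((2 : ℝ) - 1 / (d : ℝ)) +
              α * (N : ℝ) ^ (((d : ℝ) + 1) / (d : ℝ))) =
              (N : ℝ) ^ ((2 : ℝ) - 1 / (d : ℝ)) + C₁ * α * (N : ℝ) ^ (((d : ℝ) + 1) / (d : ℝ)) := by
            rw [hS]; ring
          linarith [p0, p1, e]
  -- take square roots
  have hsqrt : (N : ℝ) * Real.sqrt ((F - 2 * d * (N : ℝ) ^ θ₁) / (2 * d * (N : ℝ) ^ θ₁)) ≤
      (1 + C₁) * Real.sqrt S := by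
    have hN2 : (N : ℝ) * Real.sqrt ((F - 2 * d * (N : ℝ) ^ θ₁) / (2 * d * (N : ℝ) ^ θ₁)) =
        Real.sqrt ((N : ℝ) ^ (2 : ℕ) * ((F - 2 * d * (N : ℝ) ^ θ₁) / (2 * d * (N : ℝ) ^ θ₁))) := by
      rw [Real.sqrt_mul (by positivity), Real.sqrt_sq hNpos.le]
    rw [hN2]
    calc Real.sqrt ((N : ℝ) ^ 2 * ((F - 2 * d * (N : ℝ) ^ θ₁) / (2 * d * (N : ℝ) ^ θ₁)))
        ≤ Real.sqrt ((1 + C₁) * S) := Real.sqrt_le_sqrt hq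
      _ = Real.sqrt (1 + C₁) * Real.sqrt S := Real.sqrt_mul' _ hS0
      _ ≤ (1 + C₁) * Real.sqrt S := by
          refine mul_le_mul_of_nonneg_right ?_ (Real.sqrt_nonneg _)
          rw [Real.sqrt_le_left (by linarith)]
          nlinarith
  rw [← Real.sqrt_eq_rpow]
  calc (N : ℝ) * (C * Real.sqrt ((F - 2 * d * (N : ℝ) ^ θ₁) / (2 * d * (N : ℝ) ^ θ₁)))
      = C * ((N : ℝ) * Real.sqrt ((F - 2 * d * (N : ℝ) ^ θ₁) / (2 * d * (N : ℝ) ^ θ₁))) := by ring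
    _ ≤ C * ((1 + C₁) * Real.sqrt S) := mul_le_mul_of_nonneg_left hsqrt hC
    _ = C * (1 + C₁) * Real.sqrt S := by ring

/-- **Cicalese–Leonardi 2020, §3.1 — the almost-minimiser fluctuation law on `ℤ^d` — CLOSED MODULO the
Figalli–Maggi–Pratelli quantitative Wulff inequality (the source's Theorem 2.1 = [11]).**  From the named
fact `FigalliMaggiPratelli2010_quantitativeWulff` for the open cube `W = (−1,1)^d` (density `‖ν‖₁`,
`W_v` the open cube of volume `v`), the Q-closeness data PROVED in the tree — (2.13)
`F(ζ(X)) ≤ E_N(X)` (`anisotropicPerimeter_cubeUnion_le`), (2.14)+(3.20)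
`inf E_N ≤ F(W_N) + C_d N^{1−2/d}` (`eipValue_le_rpow` with `F(W_N) = 2dN^{(d−1)/d}`,
`anisotropicPerimeter_closure_normalisedDilate`) — and the three-line Proposition 1, one obtains the printed
`inf_x |V(X) △ (x + W_N)| ≤ c_d (α_N N^{(d+1)/d} + N^{2−1/d})^{1/2}` for every `α_N`-minimiser, i.e. the
named fact `CicaleseLeonardi2020_cubicLattice` of `LatticeMaximalFluctuations.lean`.
[cite: CicaleseLeonardi2020, Theorem 2.1, Proposition 1 (2.15) p. 5, §3.1 (3.17)–(3.20) p. 6–7;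
FigalliMaggiPratelli2010, Theorem 1.1] -/
theorem CicaleseLeonardi2020.CicaleseLeonardi2020_cubicLattice_of_quantitativeWulff
    (h : FigalliMaggiPratelli2010_quantitativeWulff) :
    CicaleseLeonardi2020.CicaleseLeonardi2020_cubicLattice := by
  classical
  intro d hd
  have hd1 : 1 ≤ d := by omega
  obtain ⟨n, hn⟩ : ∃ n, d = n + 1 := ⟨d - 1, by omega⟩
  obtain ⟨hWo, hWb, hWc, hW0, hWvol, hWcl, hWball⟩ := openUnitCube_facts d
  set W := {y : EuclideanSpace ℝ (Fin d) | ∀ i, |y i| < 1} with hW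
  obtain ⟨C, hC, hq⟩ := h d hd W hWo hWb hWc hW0
  obtain ⟨C₁, hC₁, hE⟩ := eipValue_le_rpow hd
  refine ⟨C * (1 + C₁) + 1, by positivity, fun N α hα X hcard hmin => ?_⟩
  obtain ⟨A, rfl⟩ := CicaleseLeonardi2020.exists_eq_image_intVec hmin.1
  have hcardA : #A = N := by rwa [card_image_of_injective _ (intVec_injective d)] at hcard
  set D := CicaleseLeonardi2020.cubeUnion (A.image (intVec d)) with hD
  -- N = 0: everything vanishes
  rcases Nat.eq_zero_or_pos N with hN0 | hNpos
  · subst hN0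
    have hA0 : A = ∅ := card_eq_zero.1 hcardA
    subst hA0
    refine (iInf_le _ (0 : EuclideanSpace ℝ (Fin d))).trans ?_
    have e : CicaleseLeonardi2020.cubeUnion ((∅ : Finset (Site d)).image (intVec d)) = ∅ := by
      simp [CicaleseLeonardi2020.cubeUnion]
    have e2 : (∅ : Set (EuclideanSpace ℝ (Fin d))) ∆ ((0 : EuclideanSpace ℝ (Fin d)) +ᵥ
        CicaleseLeonardi2020.wulffCube d 0) = (0 : EuclideanSpace ℝ (Fin d)) +ᵥ CicaleseLeonardi2020.wulffCube d 0 := by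
      rw [← Set.bot_eq_empty, bot_symmDiff]
    rw [hD, e, e2, CicaleseLeonardi2020.volume_vadd_wulffCube hd1, Nat.cast_zero, ENNReal.ofReal_zero]
    exact zero_le
  -- N ≥ 1: the data of the quantitative inequality
  have hN : (0 : ℝ) < N := by exact_mod_cast hNpos
  have hvolD : volume D = ENNReal.ofReal (N : ℝ) := by
    rw [hD, volume_cubeUnion_image_intVec, hcardA, ENNReal.ofReal_natCast]
  have hPle : anisotropicPerimeter (closure W) D ≤ (#(boundaryPairs A) : ℝ≥0∞) := by
    subst hn; exact anisotropicPerimeter_cubeUnion_le hWcl A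
  have hfin : HasFinitePerimeter D := by
    refine ⟨CicaleseLeonardi2020.measurableSet_cubeUnion _, ?_⟩
    have h1 := mul_perimeter_le_anisotropicPerimeter (by norm_num : (0 : ℝ) < 1 / 2) hWball D
    have h2 : ENNReal.ofReal (1 / 2) * perimeter D < ⊤ :=
      lt_of_le_of_lt (h1.trans hPle) (ENNReal.natCast_lt_top _)
    rcases ENNReal.mul_lt_top_iff.1 h2 with ⟨-, hP⟩ | h0 | h0
    · exact hP
    · exact absurd (ENNReal.ofReal_eq_zero.1 h0) (by norm_num)
    · rw [h0]; exact ENNReal.zero_lt_top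
  obtain ⟨hFWpos, hdev⟩ := hq D N hN hfin hvolD
  -- the values F(D) ≤ E(X) ≤ EIP + α ≤ 2dN^θ₁ + C₁N^θ₂ + α and F(W_N) = 2dN^θ₁
  have hFW : (anisotropicPerimeter (closure W) (normalisedDilate W N)).toReal =
      2 * d * (N : ℝ) ^ (((d : ℝ) - 1) / d) := by
    rw [anisotropicPerimeter_closure_normalisedDilate hd hWb hWc hW0 (by rw [hWvol]; positivity) hN, hWvol,
      ENNReal.toReal_mul, ENNReal.toReal_mul, ENNReal.toReal_natCast,
      ENNReal.toReal_ofReal (by positivity), ENNReal.toReal_ofReal (by positivity)]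
    have hd0 : (d : ℝ) ≠ 0 := by exact_mod_cast (show d ≠ 0 by omega)
    have hr : ((N : ℝ) / (2 : ℝ) ^ d) ^ ((1 : ℝ) / (d : ℝ)) = (N : ℝ) ^ ((1 : ℝ) / (d : ℝ)) / 2 := by
      rw [Real.div_rpow hN.le (by positivity), ← Real.rpow_natCast (2 : ℝ) d, ← Real.rpow_mul (by norm_num),
        mul_one_div_cancel hd0, Real.rpow_one]
    rw [hr, div_pow, ← Real.rpow_natCast ((N : ℝ) ^ ((1 : ℝ) / (d : ℝ))) (d - 1),
      ← Real.rpow_mul hN.le, Nat.cast_sub hd1, Nat.cast_one]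
    have e3 : (1 : ℝ) / d * ((d : ℝ) - 1) = ((d : ℝ) - 1) / d := by field_simp
    rw [e3]
    have e4 : (2 : ℝ) ^ d = 2 ^ (d - 1) * 2 := by
      rw [← pow_succ]; congr 1; omega
    rw [e4]
    field_simp
  have hFD : (anisotropicPerimeter (closure W) D).toReal ≤
      2 * d * (N : ℝ) ^ (((d : ℝ) - 1) / d) + C₁ * (N : ℝ) ^ (((d : ℝ) - 2) / d) + α := by
    have h1 : (anisotropicPerimeter (closure W) D).toReal ≤ (#(boundaryPairs A) : ℝ) :=
      ENNReal.toReal_le_of_le_ofReal (Nat.cast_nonneg _) (by rwa [ENNReal.ofReal_natCast])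
    -- almost-minimality against an exact minimizer
    obtain ⟨B, hB, hBN⟩ := exists_isEIPMinimizer_card_eq n N
    subst hn
    have h2 := hmin.2 (B.image (intVec (n + 1))) (CicaleseLeonardi2020.coe_image_intVec_subset B)
      (by rw [card_image_of_injective _ (intVec_injective _), card_image_of_injective _ (intVec_injective _),
        hBN, hcardA])
    simp only [CicaleseLeonardi2020.cubicExcess_image_intVec] at h2
    rw [hB.card_boundaryPairs_eq hBN] at h2
    have h3 := hE N
    linarith
  -- the deviation with the open Wulff cube, bounded by Figalli–Maggi–Pratelli
  have hmain : (⨅ x : EuclideanSpace ℝ (Fin d), volume (D ∆ (x +ᵥ normalisedDilate W N))) ≤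
      ENNReal.ofReal ((C * (1 + C₁) + 1) * (α * (N : ℝ) ^ (((d : ℝ) + 1) / (d : ℝ)) +
        (N : ℝ) ^ ((2 : ℝ) - 1 / (d : ℝ))) ^ ((1 : ℝ) / 2)) := by
    refine hdev.trans (ENNReal.ofReal_le_ofReal ?_)
    rw [hFW]
    refine (deviation_arith hd hNpos hC.le hC₁.le hα hFD).trans ?_
    have : 0 ≤ (α * (N : ℝ) ^ (((d : ℝ) + 1) / (d : ℝ)) + (N : ℝ) ^ ((2 : ℝ) - 1 / (d : ℝ))) ^ ((1 : ℝ) / 2) :=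
      by positivity
    nlinarith
  -- replace the open cube by Cicalese–Leonardi's closed cube (a null set apart)
  have hopen := normalisedDilate_openUnitCube hd1 hN
  have hiInf : CicaleseLeonardi2020.translationDeviation D (CicaleseLeonardi2020.wulffCube d N) =
      ⨅ x : EuclideanSpace ℝ (Fin d), volume (D ∆ (x +ᵥ normalisedDilate W N)) := by
    unfold CicaleseLeonardi2020.translationDeviation
    refine iInf_congr fun x => measure_congr ?_
    rw [hopen]
    exact (Filter.EventuallyEq.refl _ D).symmDiff (vadd_openCube_ae_eq_vadd_closedCube x _).symm
  rw [hiInf]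
  exact hmain

end AlmostMinimizers

end Literature.MathematicalPhysics.StatisticalMechanics

end
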